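import Literature.Geometry.Lorentzian.KerrData
import Literature.Geometry.Lorentzian.ChartScalarCurvature
import Mathlib.Analysis.InnerProductSpace.Calculus
import Mathlib.Analysis.SpecialFunctions.Sqrt
import Mathlib.Analysis.Calculus.Deriv.Inv
import HarnessLib

/-!
# The Schwarzschild (`a = 0`) Kerr–Schild slice data in closed form, I: the induced metric
# and its scalar curvature

Support file (all results proved; no definitions of mathematical content beyond explicit
closed-form expressions, no named facts) for the verification that the Schwarzschild initial
data `Kerr.data M 0 r₀` (`KerrData.lean`: the data induced by the Kerr–Schild metric
`g = η + 2H ℓ ⊗ ℓ` on the slice `{t* = 0} ∩ {r > max r₀ 0}`) solve the vacuum constraint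
equations — the `a = 0` instance of the named fact `Kerr.data_isVacuumConstraintSolution`
(Choquet-Bruhat 2009, Ch. VI, Thm. 3.3; Cook, Living Rev. Relativ. 3 (2000) 5, §3.2.2,
(55)–(57); García-Parrado–Valiente Kroon, J. Geom. Phys. 58 (2008), §5).

For `a = 0` the Kerr–Schild radius is `r = ‖y‖`, `H = M / r` and `ℓ = (1, y / r)`, so the
induced metric on the slice (an open subset of `E3`, whose preferred charts are the inclusion,
`ChartCalculus.lean`) has the representative

  `hRep M y = δ + (2M / ‖y‖³) ⟪y, ·⟫ ⊗ ⟪y, ·⟫`,  i.e. `h_ij = δ_ij + 2M yᵢ yⱼ / r³`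

(Cook 2000, (55): `γ_ij = δ_ij + 2H ℓᵢ ℓⱼ`). This file proves:

* `Kerr.mfderiv_sliceEmbed_apply` — `d(sliceEmbed)_y v = (0, v)` (any `a`);
* `Kerr.bilin_zero_ofTimeSpace` — `g_{M,0}((0,v),(0,w)) = hRep M y v w` at `(0, y)`;
* `Kerr.data_metric_val_zero` — **the representative**: `(Kerr.data M 0 r₀).metric.val y = hRep M y`
  (the hypothesis `hG` of the chart-calculus files);
* the calculus of `hRep` away from the origin: `hasFDerivAt_hRep` (explicit derivative
  `hRepDeriv`), `fderiv_hRep_apply`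
  (`(∂_v h)(a, b) = −6M r⁻⁵ ⟪y,v⟫⟪y,a⟫⟪y,b⟫ + 2M r⁻³ (⟪v,a⟫⟪y,b⟫ + ⟪y,a⟫⟪v,b⟫)`),
  `koszulForm_hRep` (**the Christoffel symbols of the first kind**: the Koszul form of
  `ChartCalculus.lean` is `K(Y, X, Z) = 2 c(X, Y) ⟪y, Z⟫` with
  `c(X, Y) = cKS M y X Y = 2M r⁻³ ⟪X, Y⟫ − 3M r⁻⁵ ⟪y, X⟫⟪y, Y⟫`, O'Neill 1983, Ch. 3,
  Prop. 3.13), and the second-order quantities entering the coordinate formulas for the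
  curvature (`ChartConnection.val_riemann_eq`, `ChartScalarCurvature.scalarCurvature_eq_coord`):
  `hasFDerivAt_cKS`/`fderiv_cKS_apply` (`∂_X c(Y, Z) = dcKS M y X Y Z`) and
  `fderiv_koszulForm_hRep` (`∂_X K(Z, Y, W) = 2 (∂_X c(Y,Z) ⟪y, W⟫ + c(Y,Z) ⟪X, W⟫)`).

**Main result** (`Kerr.scalarCurvature_data_zero`, last section): the scalar curvature of the
induced metric `h = δ + (2M/r³) y ⊗ y` of the Kerr–Schild slice of Schwarzschild is

  `R(h)(y) = 8 M² / (r² (r + 2M)²)`   (`r = ‖y‖`; `= 8M²α⁴/r⁴`, `α = (1 + 2M/r)^{-1/2}`).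

(`h = (1 + 2M/r) dr² + r² dΩ²` is the spatial metric of ingoing Eddington–Finkelstein
coordinates; for `h = A(r) dr² + r² dΩ²` one has `R = 2(1 − A⁻¹)/r² + 2A'/(r A²)`, which for
`A = 1 + 2M/r` gives `8M²/(r²(r+2M)²)`; it equals `|k|²_h − (tr_h k)²` for the second
fundamental form `k` of the slice, Cook 2000, (57) — the Hamiltonian constraint, verified in the
sequel.) **Proof.** The coordinate formula `OpensChart.scalarCurvature_eq_coord`
(`ChartScalarCurvature.lean`: `S = ∑ g^{lk} g^{ji} [½(∂ᵢK_{lkj} − ∂_k K_{lij}) − g^{ca}(¼K_{jic}K_{lka}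
− ¼K_{jkc}K_{lia})]`) is evaluated with the representative `hRep M`, the closed forms
`koszulForm_hRep`, `fderiv_koszulForm_hRep`, in an orthonormal basis `b` of `E3` **adapted to the
point**, `b 2 = y/‖y‖` (`exists_orthonormalBasis_adapted`): there `⟪y, bᵢ⟫ = r δᵢ₂`, the Gram
matrix is `diag(1, 1, 1 + 2M/r)` (`gram_hRep_adapted`, inverse `gram_hRep_adapted_inv`),
`c(bᵢ, bⱼ) = (M/r³)(2δᵢⱼ − 3δᵢ₂δⱼ₂)` (`cKS_adapted`) and
`∂_{bᵢ} c(b_k, b_l) = (M/r⁴)(−6δᵢ₂δ_{kl} + 15δᵢ₂δ_{k2}δ_{l2} − 3(δ_{ik}δ_{l2} + δ_{k2}δ_{il}))`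
(`dcKS_adapted`); the collapsed finite sum is a rational identity in `M`, `r` closed by `ring`.

Everything is proved; the definitions are explicit closed-form expressions (no named facts).
The sequel files compute the second fundamental form and the constraint functions of
`Kerr.data M 0 r₀`.

## References

* G. B. Cook, *Initial data for numerical relativity*, Living Rev. Relativ. 3 (2000) 5, §3.2.2,
  (55)–(57) (Kerr–Schild slices).
* A. García-Parrado, J. A. Valiente Kroon, *Kerr initial data*, J. Geom. Phys. 58 (2008), §5.
* B. O'Neill, *Semi-Riemannian geometry* (1983), Ch. 3, Prop. 3.13, Lemma 3.38, Def. 3.53.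
* Y. Choquet-Bruhat, *General Relativity and the Einstein Equations* (2009), Ch. VI, Thm. 3.3.
-/

noncomputable section

-- instance search through the nested operator types `E3 →L E3 →L E3 →L ℝ` (as in `ChartCurvature`)
set_option maxSynthPendingDepth 3

open Bundle TopologicalSpace Manifold Set Module
open scoped ContDiff Topology InnerProductSpace

namespace Literature.Geometry.Lorentzian

/-! ### Covectors on `E3` and the representative `hRep` -/

namespace E3

/-- The Euclidean metric `δ` of `E3` as a continuous bilinear form (`innerSL ℝ` read at the type
`E3 →L[ℝ] E3 →L[ℝ] ℝ`). O'Neill 1983, Ch. 3, p. 55. [cite: ONeill1983, Ch. 3, p. 55] -/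
def delta : E3 →L[ℝ] E3 →L[ℝ] ℝ := (innerSL ℝ (E := E3) : E3 →L[ℝ] E3 →L[ℝ] ℝ)

/-- `δ(v, w) = ⟪v, w⟫`. [cite: ONeill1983, Ch. 3, p. 55] -/
@[simp]
theorem delta_apply (v w : E3) : delta v w = ⟪v, w⟫_ℝ := rfl

/-- The covector `⟪y, ·⟫` on `E3`. [folklore] -/
def covec (y : E3) : E3 →L[ℝ] ℝ := (innerSL ℝ (E := E3) : E3 →L[ℝ] E3 →L[ℝ] ℝ) y

/-- `covec y v = ⟪y, v⟫`. [folklore] -/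
@[simp]
theorem covec_apply (y v : E3) : covec y v = ⟪y, v⟫_ℝ := rfl

/-- `covec` is the continuous linear map `innerSL ℝ`. [folklore] -/
theorem covec_eq (y : E3) : covec y = (innerSL ℝ (E := E3) : E3 →L[ℝ] E3 →L[ℝ] ℝ) y := rfl

end E3

namespace Kerr

/-- **The induced metric of the Schwarzschild Kerr–Schild slice, as a function on `E3`**:
`hRep M y = δ + (2M / ‖y‖³) ⟪y, ·⟫ ⊗ ⟪y, ·⟫`, i.e. `h_ij = δ_ij + 2H ℓᵢ ℓⱼ` with `H = M / r`,
`ℓ⃗ = y / r`, `r = ‖y‖` (junk value `δ` at `y = 0`, where `‖y‖⁻³ = 0`); the rank-one form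
`⟪y, ·⟫ ⊗ ⟪y, ·⟫` is Mathlib's `ContinuousLinearMap.smulRight` (as `E4.tmul` in `KerrSchild`).
Cook 2000, §3.2.2, (55); García-Parrado–Valiente Kroon 2008, §5. [cite: Cook2000, §3.2.2 (55)] -/
def hRep (M : ℝ) (y : E3) : E3 →L[ℝ] E3 →L[ℝ] ℝ :=
  E3.delta + (2 * M / ‖y‖ ^ 3) • (E3.covec y).smulRight (E3.covec y)

/-- `hRep M y v w = ⟪v, w⟫ + (2M / ‖y‖³) ⟪y, v⟫ ⟪y, w⟫` (Cook 2000, (55)).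
[cite: Cook2000, §3.2.2 (55)] -/
@[simp]
theorem hRep_apply (M : ℝ) (y v w : E3) :
    hRep M y v w = ⟪v, w⟫_ℝ + 2 * M / ‖y‖ ^ 3 * (⟪y, v⟫_ℝ * ⟪y, w⟫_ℝ) := by
  simp [hRep, ContinuousLinearMap.smulRight_apply]

/-- `hRep M y` is symmetric. [cite: Cook2000, §3.2.2 (55)] -/
theorem hRep_symm (M : ℝ) (y v w : E3) : hRep M y v w = hRep M y w v := by
  rw [hRep_apply, hRep_apply, real_inner_comm v w, mul_comm ⟪y, v⟫_ℝ]

/-! ### The slice and the Kerr–Schild quantities at `a = 0` -/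

/-- For `a = 0` the Kerr–Schild radius of `(0, y)` is `‖y‖`. Dafermos–Rodnianski
arXiv:0811.0354, §5.1. [cite: arXiv08110354, §5.1] -/
theorem radius_zero_ofTimeSpace (y : E3) : radius 0 (E4.ofTimeSpace 0 y) = ‖y‖ := by
  rw [radius_zero_left, E4.spatialNorm_ofTimeSpace]

/-- Membership in the Schwarzschild slice: `y ∈ Kerr.slice 0 r₀ ↔ max r₀ 0 < ‖y‖`.
Dafermos–Rodnianski arXiv:0811.0354, §5.1. [cite: arXiv08110354, §5.1] -/
theorem mem_slice_zero_iff {r₀ : ℝ} {y : E3} : y ∈ slice 0 r₀ ↔ max r₀ 0 < ‖y‖ := by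
  rw [mem_slice, radius_zero_ofTimeSpace]

/-- Points of the Schwarzschild slice have positive norm. [cite: arXiv08110354, §5.1] -/
theorem norm_pos_of_mem_slice_zero {r₀ : ℝ} (y : slice 0 r₀) : 0 < ‖(y : E3)‖ :=
  (le_max_right r₀ 0).trans_lt (mem_slice_zero_iff.1 y.2)

/-- Points of the Schwarzschild slice are nonzero. [cite: arXiv08110354, §5.1] -/
theorem ne_zero_of_mem_slice_zero {r₀ : ℝ} (y : slice 0 r₀) : (y : E3) ≠ 0 :=
  norm_pos_iff.1 (norm_pos_of_mem_slice_zero y)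

/-- For `a = 0`, `H(0, y) = M / ‖y‖` (`H = M r³ / r⁴`; `y ≠ 0`). Visser arXiv:0706.0622, (33).
[cite: arXiv07060622, (33)] -/
theorem scalarH_zero_ofTimeSpace (M : ℝ) {y : E3} (hy : y ≠ 0) :
    scalarH M 0 (E4.ofTimeSpace 0 y) = M / ‖y‖ := by
  have hr : ‖y‖ ≠ 0 := norm_ne_zero_iff.2 hy
  rw [scalarH, radius_zero_ofTimeSpace]
  field_simp
  ring

/-- For `a = 0`, the Kerr–Schild covector at `(0, y)` evaluated on a tangent vector `(0, v)` of
the slice is `ℓ(0, v) = ⟪y, v⟫ / ‖y‖` (`ℓ = (1, y / r)`). Visser arXiv:0706.0622, (34).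
[cite: arXiv07060622, (34)] -/
theorem nullCovector_zero_ofTimeSpace (y v : E3) :
    nullCovector 0 (E4.ofTimeSpace 0 y) (E4.ofTimeSpace 0 v) = ⟪y, v⟫_ℝ / ‖y‖ := by
  rw [nullCovector, E4.covector_apply, Fin.sum_univ_four]
  simp only [nullCovectorFun, radius_zero_ofTimeSpace, Fin.isValue, Matrix.cons_val_zero,
    E4.ofTimeSpace_apply_zero, mul_zero, Matrix.cons_val_one, zero_add, Matrix.cons_val]
  have h1 : (E4.ofTimeSpace 0 y) 1 = y 0 := E4.ofTimeSpace_apply_succ 0 y 0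
  have h2 : (E4.ofTimeSpace 0 y) 2 = y 1 := E4.ofTimeSpace_apply_succ 0 y 1
  have h3 : (E4.ofTimeSpace 0 y) 3 = y 2 := E4.ofTimeSpace_apply_succ 0 y 2
  have h1' : (E4.ofTimeSpace 0 v) 1 = v 0 := E4.ofTimeSpace_apply_succ 0 v 0
  have h2' : (E4.ofTimeSpace 0 v) 2 = v 1 := E4.ofTimeSpace_apply_succ 0 v 1
  have h3' : (E4.ofTimeSpace 0 v) 3 = v 2 := E4.ofTimeSpace_apply_succ 0 v 2
  rw [h1, h2, h3, h1', h2', h3']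
  have hin : ⟪y, v⟫_ℝ = y 0 * v 0 + y 1 * v 1 + y 2 * v 2 := by
    simp [PiLp.inner_apply, Fin.sum_univ_three, mul_comm]
  rw [hin]
  by_cases hr : ‖y‖ = 0
  · simp [hr]
  · field_simp
    ring

/-- **The Schwarzschild Kerr–Schild metric on tangent vectors of the slice**: at `(0, y)`,
`y ≠ 0`, `g_{M,0}((0, v), (0, w)) = ⟪v, w⟫ + (2M/‖y‖³) ⟪y, v⟫⟪y, w⟫ = hRep M y v w`
(`η((0,v),(0,w)) = ⟪v, w⟫`, `2H ℓ(0,v) ℓ(0,w) = 2 (M/r) (⟪y,v⟫/r)(⟪y,w⟫/r)`). Cook 2000, (55).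
[cite: Cook2000, §3.2.2 (55)] -/
theorem bilin_zero_ofTimeSpace (M : ℝ) {y : E3} (hy : y ≠ 0) (v w : E3) :
    bilin M 0 (E4.ofTimeSpace 0 y) (E4.ofTimeSpace 0 v) (E4.ofTimeSpace 0 w) = hRep M y v w := by
  have hr : ‖y‖ ≠ 0 := norm_ne_zero_iff.2 hy
  rw [bilin_apply, scalarH_zero_ofTimeSpace M hy, nullCovector_zero_ofTimeSpace,
    nullCovector_zero_ofTimeSpace, hRep_apply]
  have hη : Minkowski.bilin (E4.ofTimeSpace 0 v) (E4.ofTimeSpace 0 w) = ⟪v, w⟫_ℝ := by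
    rw [Minkowski.bilin_apply]
    simp only [E4.ofTimeSpace_apply_zero, E4.ofTimeSpace_apply_succ, mul_zero, neg_zero,
      zero_add, PiLp.inner_apply, RCLike.inner_apply, conj_trivial]
    exact Finset.sum_congr rfl fun i _ ↦ mul_comm _ _
  rw [hη]
  field_simp

/-! ### The differential of the slice embedding and the representative of the data -/

/-- **The differential of the slice embedding** `Kerr.sliceEmbed a r₀ : y ↦ (0, y)` is
`v ↦ (0, v)` (any `a`, `r₀`): composed with the inclusion `Kerr.region a r₀ ⊆ E4` (whose
differential is the identity in the preferred charts, `OpensChart.mfderiv_eq`) it is the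
restriction of the linear map `E4.ofTimeSpace 0`. Dafermos–Rodnianski arXiv:0811.0354, §5.1.
[cite: arXiv08110354, §5.1] -/
theorem mfderiv_sliceEmbed_apply (a r₀ : ℝ) (y : slice a r₀) (v : E3) :
    mfderiv 𝓘(ℝ, E3) 𝓘(ℝ, E4) (sliceEmbed a r₀) y v = E4.ofTimeSpace 0 v := by
  -- the slice map `y ↦ (0, y)` is linear (`Minkowski.isLinearMap_ofTimeSpace_zero` of
  -- `ModelDataProofs`, re-derived to keep that file out of the import closure)
  have hlin : IsLinearMap ℝ (E4.ofTimeSpace 0) := by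
    constructor
    · intro y y'
      ext i
      refine Fin.cases ?_ (fun j ↦ ?_) i <;> simp
    · intro c y
      ext i
      refine Fin.cases ?_ (fun j ↦ ?_) i <;> simp
  set L : E3 →L[ℝ] E4 := LinearMap.toContinuousLinearMap (IsLinearMap.mk' _ hlin) with hL
  have hcoe : (L : E3 → E4) = E4.ofTimeSpace 0 := rfl
  have hf : MDifferentiableAt 𝓘(ℝ, E3) 𝓘(ℝ, E4) (sliceEmbed a r₀) y :=
    (contMDiff_sliceEmbed a r₀ 1 y).mdifferentiableAt one_ne_zero
  have hval : MDifferentiableAt 𝓘(ℝ, E4) 𝓘(ℝ, E4) (Subtype.val : region a r₀ → E4)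
      (sliceEmbed a r₀ y) :=
    (OpensChart.mdifferentiableAt_iff (sliceEmbed a r₀ y) Subtype.val id (fun _ ↦ rfl)).2
      differentiableAt_id
  have h2 : mfderiv 𝓘(ℝ, E4) 𝓘(ℝ, E4) (Subtype.val : region a r₀ → E4) (sliceEmbed a r₀ y) =
      ContinuousLinearMap.id ℝ E4 := by
    rw [OpensChart.mfderiv_eq (sliceEmbed a r₀ y) Subtype.val id (fun _ ↦ rfl)
      differentiableAt_id, fderiv_id]
  have h3 : mfderiv 𝓘(ℝ, E3) 𝓘(ℝ, E4) (Subtype.val ∘ sliceEmbed a r₀ : slice a r₀ → E4) y = L := by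
    rw [OpensChart.mfderiv_eq y (Subtype.val ∘ sliceEmbed a r₀) (E4.ofTimeSpace 0)
      (fun _ ↦ rfl) (by rw [← hcoe]; exact L.differentiableAt), ← hcoe, L.fderiv]
  have h4 : mfderiv 𝓘(ℝ, E3) 𝓘(ℝ, E4) (Subtype.val ∘ sliceEmbed a r₀ : slice a r₀ → E4) y =
      (mfderiv 𝓘(ℝ, E4) 𝓘(ℝ, E4) (Subtype.val : region a r₀ → E4) (sliceEmbed a r₀ y)).comp
        (mfderiv 𝓘(ℝ, E3) 𝓘(ℝ, E4) (sliceEmbed a r₀) y) :=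
    mfderiv_comp y hval hf
  have h5 := DFunLike.congr_fun h4 v
  rw [h3, h2] at h5
  exact h5.symm

/-- The metric of the Schwarzschild data at `y`, on vectors: `h_y(v, w) = hRep M y v w`.
Cook 2000, (55). [cite: Cook2000, §3.2.2 (55)] -/
theorem data_h_inner_zero_apply [Facts] [SliceFacts] (M : ℝ) (hM : 0 ≤ M) {r₀ : ℝ}
    (y : slice 0 r₀) (v w : E3) :
    (data M 0 r₀ hM).h.inner y v w = hRep M y v w := by
  rw [data_h_inner, PseudoRiemannianMetric.inducedBilin_apply, smoothMetric_val,
    mfderiv_sliceEmbed_apply, mfderiv_sliceEmbed_apply, coe_sliceEmbed]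
  exact bilin_zero_ofTimeSpace M (ne_zero_of_mem_slice_zero y) v w

/-- **The representative of the Schwarzschild data** (hypothesis `hG` of `ChartCalculus.lean`,
`ChartConnection.lean`, `ChartScalarCurvature.lean`): `(Kerr.data M 0 r₀).metric.val y = hRep M y`.
Cook 2000, (55). [cite: Cook2000, §3.2.2 (55)] -/
theorem data_metric_val_zero [Facts] [SliceFacts] (M : ℝ) (hM : 0 ≤ M) {r₀ : ℝ} :
    ∀ y : slice 0 r₀, (data M 0 r₀ hM).metric.val y = hRep M y := fun y ↦ by
  rw [InitialDataSet.val_metric]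
  exact ContinuousLinearMap.ext fun v ↦ ContinuousLinearMap.ext fun w ↦
    data_h_inner_zero_apply M hM y v w

/-! ### Calculus of `hRep`: first derivatives and the Christoffel symbols of the first kind -/

section Calculus

variable {y : E3}

/-- The derivative of the Euclidean norm of `E3` away from the origin:
`D‖·‖(y) = ‖y‖⁻¹ ⟪y, ·⟫`. [folklore] -/
theorem hasFDerivAt_norm_E3 (hy : y ≠ 0) :
    HasFDerivAt (fun y : E3 ↦ ‖y‖) (‖y‖⁻¹ • E3.covec y) y := by
  have h1 : HasFDerivAt (fun y : E3 ↦ ‖y‖ ^ 2) (2 • (innerSL ℝ y : E3 →L[ℝ] ℝ)) y :=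
    (hasStrictFDerivAt_norm_sq y).hasFDerivAt
  have hx2 : ‖y‖ ^ 2 ≠ 0 := by positivity
  have h3 : HasFDerivAt (fun y : E3 ↦ Real.sqrt (‖y‖ ^ 2))
      ((1 / (2 * Real.sqrt (‖y‖ ^ 2))) • (2 • (innerSL ℝ y : E3 →L[ℝ] ℝ))) y :=
    (Real.hasDerivAt_sqrt hx2).comp_hasFDerivAt y h1
  simp only [Real.sqrt_sq_eq_abs, abs_norm] at h3
  refine h3.congr_fderiv ?_
  have hx' : ‖y‖ ≠ 0 := norm_ne_zero_iff.2 hy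
  rw [← Nat.cast_smul_eq_nsmul ℝ, smul_smul]
  congr 1
  push_cast
  field_simp

/-- `D(‖·‖ⁿ)⁻¹(y) = −n ‖y‖^{−(n+2)} ⟪y, ·⟫` away from the origin. [folklore] -/
theorem hasFDerivAt_inv_norm_pow (hy : y ≠ 0) (n : ℕ) :
    HasFDerivAt (fun y : E3 ↦ (‖y‖ ^ n)⁻¹) ((-(n : ℝ) / ‖y‖ ^ (n + 2)) • E3.covec y) y := by
  have hr : ‖y‖ ≠ 0 := norm_ne_zero_iff.2 hy
  have h1 := (hasFDerivAt_norm_E3 hy).pow n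
  have h2 := (hasDerivAt_inv (pow_ne_zero n hr)).comp_hasFDerivAt y h1
  refine h2.congr_fderiv ?_
  ext v
  simp only [FunLike.coe_smul, Pi.smul_apply, E3.covec_apply, smul_eq_mul, nsmul_eq_mul]
  rcases n with _ | n
  · simp
  · rw [pow_succ]
    field_simp
    push_cast
    ring

/-- The coefficient `2M / ‖y‖³` of `hRep` has derivative `−6M ‖y‖⁻⁵ ⟪y, ·⟫`. [folklore] -/
theorem hasFDerivAt_coeff (M : ℝ) (hy : y ≠ 0) :
    HasFDerivAt (fun y : E3 ↦ 2 * M / ‖y‖ ^ 3) ((-(6 * M) / ‖y‖ ^ 5) • E3.covec y) y := by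
  have h := (hasFDerivAt_inv_norm_pow hy 3).const_mul (2 * M)
  have h' : (fun y : E3 ↦ 2 * M / ‖y‖ ^ 3) = fun y ↦ 2 * M * (‖y‖ ^ 3)⁻¹ := by
    funext y; rw [div_eq_mul_inv]
  rw [h']
  refine h.congr_fderiv ?_
  ext v
  simp only [FunLike.coe_smul, Pi.smul_apply, E3.covec_apply, smul_eq_mul]
  push_cast
  ring

/-- `y ↦ ⟪y, ·⟫` is the continuous linear map `δ`, hence its own derivative. [folklore] -/
theorem hasFDerivAt_covec (y : E3) : HasFDerivAt E3.covec E3.delta y :=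
  E3.delta.hasFDerivAt

/-- `y ↦ ⟪y, V⟫` has derivative `⟪V, ·⟫`. [folklore] -/
theorem hasFDerivAt_inner_left (y V : E3) :
    HasFDerivAt (fun y : E3 ↦ ⟪y, V⟫_ℝ) (E3.covec V) y := by
  have h : (fun y : E3 ↦ ⟪y, V⟫_ℝ) = E3.covec V := funext fun y ↦ real_inner_comm V y
  rw [h]
  exact (E3.covec V).hasFDerivAt

/-- The derivative of the rank-one field `y ↦ ⟪y, ·⟫ ⊗ ⟪y, ·⟫`: the continuous linear map
`v ↦ ⟪y, ·⟫ ⊗ ⟪v, ·⟫ + ⟪v, ·⟫ ⊗ ⟪y, ·⟫` (Leibniz rule for the bilinear map `⊗`). [folklore] -/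
def tmulDeriv (y : E3) : E3 →L[ℝ] E3 →L[ℝ] E3 →L[ℝ] ℝ :=
  (ContinuousLinearMap.smulRightL ℝ E3 (E3 →L[ℝ] ℝ)).precompR E3 (E3.covec y) E3.delta +
    (ContinuousLinearMap.smulRightL ℝ E3 (E3 →L[ℝ] ℝ)).precompL E3 E3.delta (E3.covec y)

/-- `tmulDeriv y v a b = ⟪y, a⟫ ⟪v, b⟫ + ⟪v, a⟫ ⟪y, b⟫`. [folklore] -/
@[simp]
theorem tmulDeriv_apply (y v a b : E3) :
    tmulDeriv y v a b = ⟪y, a⟫_ℝ * ⟪v, b⟫_ℝ + ⟪v, a⟫_ℝ * ⟪y, b⟫_ℝ := by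
  simp [tmulDeriv, ContinuousLinearMap.precompR_apply, ContinuousLinearMap.precompL_apply]

/-- Leibniz rule: `D(⟪y,·⟫ ⊗ ⟪y,·⟫) = tmulDeriv y`. [folklore] -/
theorem hasFDerivAt_smulRight_covec (y : E3) :
    HasFDerivAt (fun y : E3 ↦ (E3.covec y).smulRight (E3.covec y)) (tmulDeriv y) y :=
  (ContinuousLinearMap.smulRightL ℝ E3 (E3 →L[ℝ] ℝ)).hasFDerivAt_of_bilinear
    (hasFDerivAt_covec y) (hasFDerivAt_covec y)

/-- The derivative of `hRep M` at `y ≠ 0`, as a continuous linear map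
`E3 →L (E3 →L E3 →L ℝ)`: `v ↦ (2M/‖y‖³) (⟪y,·⟫ ⊗ ⟪v,·⟫ + ⟪v,·⟫ ⊗ ⟪y,·⟫) − 6M ‖y‖⁻⁵ ⟪y, v⟫ ⟪y,·⟫ ⊗ ⟪y,·⟫`.
Cook 2000, §3.2.2 (differentiating (55)). [cite: Cook2000, §3.2.2 (55)] -/
def hRepDeriv (M : ℝ) (y : E3) : E3 →L[ℝ] E3 →L[ℝ] E3 →L[ℝ] ℝ :=
  (2 * M / ‖y‖ ^ 3) • tmulDeriv y +
    ((-(6 * M) / ‖y‖ ^ 5) • E3.covec y).smulRight ((E3.covec y).smulRight (E3.covec y))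

/-- **The first derivatives of the metric components**:
`(∂_v h)(a, b) = −6M ‖y‖⁻⁵ ⟪y,v⟫⟪y,a⟫⟪y,b⟫ + (2M/‖y‖³)(⟪v,a⟫⟪y,b⟫ + ⟪y,a⟫⟪v,b⟫)`.
[cite: Cook2000, §3.2.2 (55)] -/
@[simp]
theorem hRepDeriv_apply (M : ℝ) (y v a b : E3) :
    hRepDeriv M y v a b = -(6 * M) / ‖y‖ ^ 5 * ⟪y, v⟫_ℝ * (⟪y, a⟫_ℝ * ⟪y, b⟫_ℝ) +
      2 * M / ‖y‖ ^ 3 * (⟪v, a⟫_ℝ * ⟪y, b⟫_ℝ + ⟪y, a⟫_ℝ * ⟪v, b⟫_ℝ) := by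
  simp only [hRepDeriv, add_apply, FunLike.coe_smul, Pi.smul_apply,
    tmulDeriv_apply, smul_eq_mul, ContinuousLinearMap.smulRight_apply, E3.covec_apply]
  ring

/-- **`hRep M` is differentiable away from the origin with derivative `hRepDeriv M y`.**
[cite: Cook2000, §3.2.2 (55)] -/
theorem hasFDerivAt_hRep (M : ℝ) (hy : y ≠ 0) : HasFDerivAt (hRep M) (hRepDeriv M y) y := by
  have h := ((hasFDerivAt_coeff M hy).smul (hasFDerivAt_smulRight_covec y)).const_add E3.delta
  exact h

/-- `hRep M` is differentiable away from the origin. [cite: Cook2000, §3.2.2 (55)] -/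
theorem differentiableAt_hRep (M : ℝ) (hy : y ≠ 0) : DifferentiableAt ℝ (hRep M) y :=
  (hasFDerivAt_hRep M hy).differentiableAt

/-- **The first derivatives of `hRep`, applied**:
`fderiv (hRep M) y v a b = −6M ‖y‖⁻⁵ ⟪y,v⟫⟪y,a⟫⟪y,b⟫ + (2M/‖y‖³)(⟪v,a⟫⟪y,b⟫ + ⟪y,a⟫⟪v,b⟫)`
(`∂_k (2M yᵢ yⱼ r⁻³) = 2M r⁻³ (δᵢₖ yⱼ + δⱼₖ yᵢ) − 6M r⁻⁵ yᵢ yⱼ y_k`). Cook 2000, §3.2.2.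
[cite: Cook2000, §3.2.2 (55)] -/
theorem fderiv_hRep_apply (M : ℝ) (hy : y ≠ 0) (v a b : E3) :
    fderiv ℝ (hRep M) y v a b = -(6 * M) / ‖y‖ ^ 5 * ⟪y, v⟫_ℝ * (⟪y, a⟫_ℝ * ⟪y, b⟫_ℝ) +
      2 * M / ‖y‖ ^ 3 * (⟪v, a⟫_ℝ * ⟪y, b⟫_ℝ + ⟪y, a⟫_ℝ * ⟪v, b⟫_ℝ) := by
  rw [(hasFDerivAt_hRep M hy).fderiv, hRepDeriv_apply]

/-- The scalar `c(X, Y) = 2M ‖y‖⁻³ ⟪X, Y⟫ − 3M ‖y‖⁻⁵ ⟪y, X⟫ ⟪y, Y⟫` through which the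
Christoffel symbols of the first kind of `hRep M` factor (`koszulForm_hRep`). O'Neill 1983,
Ch. 3, Prop. 3.13. [cite: ONeill1983, Ch. 3, Prop. 3.13] -/
def cKS (M : ℝ) (y X Y : E3) : ℝ :=
  2 * M / ‖y‖ ^ 3 * ⟪X, Y⟫_ℝ - 3 * M / ‖y‖ ^ 5 * (⟪y, X⟫_ℝ * ⟪y, Y⟫_ℝ)

/-- `c(X, Y)` is symmetric. [cite: ONeill1983, Ch. 3, Prop. 3.13] -/
theorem cKS_symm (M : ℝ) (y X Y : E3) : cKS M y X Y = cKS M y Y X := by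
  rw [cKS, cKS, real_inner_comm X Y, mul_comm ⟪y, X⟫_ℝ]

/-- **The Christoffel symbols of the first kind of the Schwarzschild Kerr–Schild slice metric**:
the Koszul form of the components (`ChartCalculus.lean`: `K(Y, X, Z) = ∂_X h(Y,Z) + ∂_Y h(Z,X)
− ∂_Z h(X,Y) = 2 h(Γ(Y)(X), Z)`) is
`K(Y, X, Z) = 2 c(X, Y) ⟪y, Z⟫`, `c(X, Y) = 2M ‖y‖⁻³ ⟪X, Y⟫ − 3M ‖y‖⁻⁵ ⟪y, X⟫⟪y, Y⟫`,
i.e. `Γ_{k,ij} = (2M r⁻³ δᵢⱼ − 3M r⁻⁵ yᵢ yⱼ) y_k`. O'Neill 1983, Ch. 3, Prop. 3.13; Cook 2000,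
§3.2.2. [cite: ONeill1983, Ch. 3, Prop. 3.13] -/
theorem koszulForm_hRep (M : ℝ) (hy : y ≠ 0) (Y X Z : E3) :
    OpensChart.koszulForm (hRep M) y Y X Z = 2 * cKS M y X Y * ⟪y, Z⟫_ℝ := by
  rw [OpensChart.koszulForm_apply, fderiv_hRep_apply M hy, fderiv_hRep_apply M hy,
    fderiv_hRep_apply M hy, cKS]
  simp only [real_inner_comm Y X, real_inner_comm Z X, real_inner_comm Z Y]
  ring

/-! ### Second derivatives: the derivative of the Christoffel scalar `c` and of the Koszul form -/

/-- `D(c ‖·‖⁻ⁿ)(y) = −c n ‖y‖^{−(n+2)} ⟪y, ·⟫` away from the origin. [folklore] -/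
theorem hasFDerivAt_const_div_norm_pow (c : ℝ) (hy : y ≠ 0) (n : ℕ) :
    HasFDerivAt (fun y : E3 ↦ c / ‖y‖ ^ n) ((-(c * n) / ‖y‖ ^ (n + 2)) • E3.covec y) y := by
  have h := (hasFDerivAt_inv_norm_pow hy n).const_mul c
  have h' : (fun y : E3 ↦ c / ‖y‖ ^ n) = fun y ↦ c * (‖y‖ ^ n)⁻¹ := by
    funext y; rw [div_eq_mul_inv]
  rw [h']
  refine h.congr_fderiv ?_
  ext v
  simp only [FunLike.coe_smul, Pi.smul_apply, E3.covec_apply, smul_eq_mul]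
  ring

/-- The directional derivative `∂_X c(Y, Z)` of the Christoffel scalar `cKS`:
`−6M ‖y‖⁻⁵ ⟪y,X⟫⟪Y,Z⟫ + 15M ‖y‖⁻⁷ ⟪y,X⟫⟪y,Y⟫⟪y,Z⟫ − 3M ‖y‖⁻⁵ (⟪X,Y⟫⟪y,Z⟫ + ⟪y,Y⟫⟪X,Z⟫)`.
O'Neill 1983, Ch. 3, Lemma 3.38 (the `∂Γ` terms of the curvature). [cite: ONeill1983, Ch. 3, Lemma 3.38] -/
def dcKS (M : ℝ) (y X Y Z : E3) : ℝ :=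
  -(6 * M) / ‖y‖ ^ 5 * ⟪y, X⟫_ℝ * ⟪Y, Z⟫_ℝ + 15 * M / ‖y‖ ^ 7 * (⟪y, X⟫_ℝ * ⟪y, Y⟫_ℝ * ⟪y, Z⟫_ℝ)
    - 3 * M / ‖y‖ ^ 5 * (⟪X, Y⟫_ℝ * ⟪y, Z⟫_ℝ + ⟪y, Y⟫_ℝ * ⟪X, Z⟫_ℝ)

/-- The derivative of `y ↦ c(Y, Z)(y)` as a continuous linear map. [cite: ONeill1983, Ch. 3, Lemma 3.38] -/
def cKSDeriv (M : ℝ) (y Y Z : E3) : E3 →L[ℝ] ℝ :=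
  (⟪Y, Z⟫_ℝ * (-(6 * M) / ‖y‖ ^ 5) + ⟪y, Y⟫_ℝ * ⟪y, Z⟫_ℝ * (15 * M / ‖y‖ ^ 7)) • E3.covec y
    - (3 * M / ‖y‖ ^ 5 * ⟪y, Z⟫_ℝ) • E3.covec Y - (3 * M / ‖y‖ ^ 5 * ⟪y, Y⟫_ℝ) • E3.covec Z

/-- `cKSDeriv M y Y Z X = ∂_X c(Y, Z)`. [cite: ONeill1983, Ch. 3, Lemma 3.38] -/
@[simp]
theorem cKSDeriv_apply (M : ℝ) (y Y Z X : E3) : cKSDeriv M y Y Z X = dcKS M y X Y Z := by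
  simp only [cKSDeriv, dcKS, sub_apply, FunLike.coe_smul, Pi.smul_apply,
    E3.covec_apply, smul_eq_mul, real_inner_comm X Y, real_inner_comm X Z]
  ring

/-- **`y ↦ c(Y, Z)(y)` is differentiable away from the origin, with derivative `cKSDeriv`.**
[cite: ONeill1983, Ch. 3, Lemma 3.38] -/
theorem hasFDerivAt_cKS (M : ℝ) (hy : y ≠ 0) (Y Z : E3) :
    HasFDerivAt (fun y : E3 ↦ cKS M y Y Z) (cKSDeriv M y Y Z) y := by
  have h1 := (hasFDerivAt_const_div_norm_pow (2 * M) hy 3).mul_const ⟪Y, Z⟫_ℝ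
  have h2 := (hasFDerivAt_const_div_norm_pow (3 * M) hy 5).mul
    ((hasFDerivAt_inner_left y Y).mul (hasFDerivAt_inner_left y Z))
  refine (h1.sub h2).congr_fderiv ?_
  ext v
  simp only [cKSDeriv, sub_apply, add_apply, FunLike.coe_smul, Pi.smul_apply, E3.covec_apply,
    smul_eq_mul, Pi.mul_apply]
  push_cast
  ring

/-- `∂_X c(Y, Z) = dcKS M y X Y Z`. [cite: ONeill1983, Ch. 3, Lemma 3.38] -/
theorem fderiv_cKS_apply (M : ℝ) (hy : y ≠ 0) (Y Z X : E3) :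
    fderiv ℝ (fun y : E3 ↦ cKS M y Y Z) y X = dcKS M y X Y Z := by
  rw [(hasFDerivAt_cKS M hy Y Z).fderiv, cKSDeriv_apply]

/-- Near a point `x ≠ 0` the Koszul form of `hRep M` is `2 c(Y, Z) ⟪y, W⟫` (as germs).
[cite: ONeill1983, Ch. 3, Prop. 3.13] -/
theorem koszulForm_hRep_eventuallyEq (M : ℝ) {x : E3} (hx : x ≠ 0) (Z Y W : E3) :
    (fun y : E3 ↦ OpensChart.koszulForm (hRep M) y Z Y W) =ᶠ[𝓝 x]
      fun y ↦ 2 * cKS M y Y Z * ⟪y, W⟫_ℝ := by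
  filter_upwards [isOpen_ne.mem_nhds hx] with y hy
  exact koszulForm_hRep M hy Z Y W

/-- **The derivative of the Koszul form** (the `∂Γ` terms of the coordinate formula for the
curvature, `ChartConnection.val_riemann_eq`, `ChartScalarCurvature.scalarCurvature_eq_coord`):
for `x ≠ 0`, `∂_X K(Z, Y, W)(x) = 2 (∂_X c(Y, Z) ⟪x, W⟫ + c(Y, Z) ⟪X, W⟫)`.
O'Neill 1983, Ch. 3, Lemma 3.38. [cite: ONeill1983, Ch. 3, Lemma 3.38] -/
theorem fderiv_koszulForm_hRep (M : ℝ) {x : E3} (hx : x ≠ 0) (Z Y W X : E3) :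
    fderiv ℝ (fun y : E3 ↦ OpensChart.koszulForm (hRep M) y Z Y W) x X =
      2 * (dcKS M x X Y Z * ⟪x, W⟫_ℝ + cKS M x Y Z * ⟪X, W⟫_ℝ) := by
  rw [(koszulForm_hRep_eventuallyEq M hx Z Y W).fderiv_eq]
  have h := (((hasFDerivAt_cKS M hx Y Z).mul (hasFDerivAt_inner_left x W)).const_mul 2).fderiv
  have h' : (fun y : E3 ↦ 2 * cKS M y Y Z * ⟪y, W⟫_ℝ) =
      fun y ↦ 2 * ((fun y ↦ cKS M y Y Z) * fun y ↦ ⟪y, W⟫_ℝ) y := by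
    funext y; simp only [Pi.mul_apply]; ring
  rw [h', h]
  simp only [FunLike.coe_smul, Pi.smul_apply, add_apply, smul_eq_mul, cKSDeriv_apply,
    E3.covec_apply, real_inner_comm X W]
  ring

/-- The differentiability of the Koszul form of `hRep M` away from the origin.
[cite: ONeill1983, Ch. 3, Lemma 3.38] -/
theorem differentiableAt_koszulForm_hRep (M : ℝ) {x : E3} (hx : x ≠ 0) (Z Y W : E3) :
    DifferentiableAt ℝ (fun y : E3 ↦ OpensChart.koszulForm (hRep M) y Z Y W) x := by
  refine DifferentiableAt.congr_of_eventuallyEq ?_ (koszulForm_hRep_eventuallyEq M hx Z Y W)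
  exact (((hasFDerivAt_cKS M hx Y Z).const_mul 2).mul (hasFDerivAt_inner_left x W)).differentiableAt

end Calculus

/-! ### An orthonormal basis adapted to a point -/

/-- **An orthonormal basis of `E3` adapted to `y ≠ 0`**: there is an orthonormal basis `b` with
`b 2 = y / ‖y‖` (extend the unit vector `y/‖y‖`, Mathlib's
`Orthonormal.exists_orthonormalBasis_extension_of_card_eq`). [folklore] -/
theorem exists_orthonormalBasis_adapted {y : E3} (hy : y ≠ 0) :
    ∃ b : OrthonormalBasis (Fin 3) ℝ E3, b 2 = ‖y‖⁻¹ • y := by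
  have hcard : finrank ℝ E3 = Fintype.card (Fin 3) := by simp
  have hv : Orthonormal ℝ (({2} : Set (Fin 3)).restrict fun _ : Fin 3 ↦ ‖y‖⁻¹ • y) := by
    rw [orthonormal_subsingleton_iff]
    intro i
    simp [norm_smul, norm_ne_zero_iff.2 hy]
  obtain ⟨b, hb⟩ := Orthonormal.exists_orthonormalBasis_extension_of_card_eq hcard hv
  exact ⟨b, hb 2 rfl⟩

section Adapted

variable {M : ℝ} {y : E3} (hy : y ≠ 0) (b : OrthonormalBasis (Fin 3) ℝ E3)
  (hb : b 2 = ‖y‖⁻¹ • y)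

include hb in
/-- In an adapted basis, `y = ‖y‖ b₂`. [folklore] -/
theorem eq_norm_smul_adapted : y = ‖y‖ • b 2 := by
  by_cases hy : y = 0
  · simp [hy]
  · rw [hb, smul_smul, mul_inv_cancel₀ (norm_ne_zero_iff.2 hy), one_smul]

include hb in
/-- In an adapted basis, `⟪y, bᵢ⟫ = ‖y‖ δᵢ₂`. [folklore] -/
theorem inner_adapted (i : Fin 3) : ⟪y, b i⟫_ℝ = if i = 2 then ‖y‖ else 0 := by
  conv_lhs => rw [eq_norm_smul_adapted b hb]
  rw [real_inner_smul_left, b.inner_eq_ite]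
  by_cases h : i = 2
  · subst h; simp
  · simp [h, Ne.symm h]

/-- In an orthonormal basis, `⟪bᵢ, bⱼ⟫ = δᵢⱼ`. [folklore] -/
theorem inner_basis (i j : Fin 3) : ⟪b i, b j⟫_ℝ = if i = j then 1 else 0 := b.inner_eq_ite i j

include hb in
/-- **The Christoffel scalar in the adapted frame**: `c(bᵢ, bⱼ) = (M/r³)(2δᵢⱼ − 3δᵢ₂δⱼ₂)`.
[cite: ONeill1983, Ch. 3, Prop. 3.13] -/
theorem cKS_adapted (i j : Fin 3) :
    cKS M y (b i) (b j) =
      2 * M / ‖y‖ ^ 3 * (if i = j then 1 else 0) -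
        3 * M / ‖y‖ ^ 3 * ((if i = 2 then 1 else 0) * (if j = 2 then 1 else 0)) := by
  rw [cKS, inner_basis, inner_adapted b hb, inner_adapted b hb]
  by_cases hr : ‖y‖ = 0
  · simp [hr]
  · split_ifs <;> field_simp <;> ring

include hb in
/-- **The derivative of the Christoffel scalar in the adapted frame**:
`∂_{bᵢ} c(b_k, b_l) = (M/r⁴)(−6δᵢ₂δ_{kl} + 15δᵢ₂δ_{k2}δ_{l2} − 3(δ_{ik}δ_{l2} + δ_{k2}δ_{il}))`.
[cite: ONeill1983, Ch. 3, Lemma 3.38] -/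
theorem dcKS_adapted (i k l : Fin 3) :
    dcKS M y (b i) (b k) (b l) =
      M / ‖y‖ ^ 4 * (-6 * (if i = 2 then 1 else 0) * (if k = l then 1 else 0)
        + 15 * ((if i = 2 then 1 else 0) * (if k = 2 then 1 else 0) * (if l = 2 then 1 else 0))
        - 3 * ((if i = k then 1 else 0) * (if l = 2 then 1 else 0)
          + (if k = 2 then 1 else 0) * (if i = l then 1 else 0))) := by
  rw [dcKS, inner_basis, inner_basis, inner_basis, inner_adapted b hb, inner_adapted b hb,
    inner_adapted b hb]
  by_cases hr : ‖y‖ = 0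
  · simp [hr]
  · split_ifs <;> field_simp <;> ring

include hb in
/-- **The metric components in the adapted frame**: `h(bᵢ, bⱼ) = δᵢⱼ + (2M/r) δᵢ₂ δⱼ₂`.
[cite: Cook2000, §3.2.2 (55)] -/
theorem hRep_adapted (i j : Fin 3) :
    hRep M y (b i) (b j) =
      (if i = j then 1 else 0) + 2 * M / ‖y‖ * ((if i = 2 then 1 else 0) * (if j = 2 then 1 else 0)) := by
  rw [hRep_apply, inner_basis, inner_adapted b hb, inner_adapted b hb]
  by_cases hr : ‖y‖ = 0
  · simp [hr]
  · split_ifs <;> field_simp <;> ring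

include hb in
/-- **The Gram matrix of `hRep M y` in the adapted frame** is `diag(1, 1, 1 + 2M/‖y‖)`.
[cite: Cook2000, §3.2.2 (55)] -/
theorem gram_hRep_adapted :
    (Matrix.of fun i j ↦ hRep M y (b i) (b j)) =
      Matrix.diagonal ![1, 1, 1 + 2 * M / ‖y‖] := by
  ext i j
  rw [Matrix.of_apply, hRep_adapted b hb, Matrix.diagonal_apply]
  fin_cases i <;> fin_cases j <;> simp

include hy hb in
/-- **The inverse Gram matrix in the adapted frame** is `diag(1, 1, ‖y‖/(‖y‖ + 2M))`
(for `‖y‖ + 2M ≠ 0`). [cite: Cook2000, §3.2.2 (55)] -/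
theorem gram_hRep_adapted_inv (hM : ‖y‖ + 2 * M ≠ 0) :
    (Matrix.of fun i j ↦ hRep M y (b i) (b j))⁻¹ =
      Matrix.diagonal ![1, 1, ‖y‖ / (‖y‖ + 2 * M)] := by
  have hr : ‖y‖ ≠ 0 := norm_ne_zero_iff.2 hy
  rw [gram_hRep_adapted b hb]
  refine Matrix.inv_eq_right_inv ?_
  rw [Matrix.diagonal_mul_diagonal, ← Matrix.diagonal_one]
  congr 1
  funext i
  have h2 : (1 + 2 * M / ‖y‖) * (‖y‖ / (‖y‖ + 2 * M)) = 1 := by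
    field_simp
  fin_cases i <;> simp [h2]

end Adapted

/-! ### The scalar curvature of the Schwarzschild slice -/

/-- **The scalar curvature of the Schwarzschild Kerr–Schild slice.** For `M ≥ 0` and `y` in
the slice `{‖y‖ > max r₀ 0}`, the scalar curvature of the induced metric
`h = δ + (2M/‖y‖³) y ⊗ y` of the data `Kerr.data M 0 r₀` is
`R(h)(y) = 8M² / (‖y‖² (‖y‖ + 2M)²)` (`= 8M²α⁴/r⁴`, `α = (1 + 2M/r)^{-1/2}` the lapse of the
Kerr–Schild slicing). Cook 2000, §3.2.2, (55)–(57) (the Kerr–Schild slice data; the value of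
`R(h)` is the combination `KᵢⱼKⁱʲ − K²` of (57) by the Hamiltonian constraint); O'Neill 1983,
Ch. 3, Lemma 3.38 and Def. 3.53 (the coordinate formula, `scalarCurvature_eq_coord`).
[cite: Cook2000, §3.2.2 (55)–(57)] -/
theorem scalarCurvature_data_zero [Facts] [SliceFacts] (M : ℝ) (hM : 0 ≤ M) {r₀ : ℝ}
    (y : slice 0 r₀) [(data M 0 r₀ hM).metric.HasLeviCivita] :
    (data M 0 r₀ hM).metric.scalarCurvature y =
      8 * M ^ 2 / (‖(y : E3)‖ ^ 2 * (‖(y : E3)‖ + 2 * M) ^ 2) := by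
  have hy : (y : E3) ≠ 0 := ne_zero_of_mem_slice_zero y
  have hr : ‖(y : E3)‖ ≠ 0 := norm_ne_zero_iff.2 hy
  have hrM : ‖(y : E3)‖ + 2 * M ≠ 0 := by
    have := norm_pos_of_mem_slice_zero y; positivity
  obtain ⟨b, hb⟩ := exists_orthonormalBasis_adapted hy
  -- the adapted basis as a basis of the tangent space `T_y slice = E3`
  set β : Module.Basis (Fin 3) ℝ (TangentSpace 𝓘(ℝ, E3) y) := b.toBasis with hβdef
  have hβ : ∀ i, β i = b i := fun i ↦ congrFun b.coe_toBasis i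
  rw [OpensChart.scalarCurvature_eq_coord (data_metric_val_zero M hM) y β]
  simp only [hβ]
  rw [gram_hRep_adapted_inv hy b hb hrM]
  simp only [koszulForm_hRep M hy, fderiv_koszulForm_hRep M hy]
  -- collapse the sums against the diagonal inverse Gram matrix
  simp only [Matrix.diagonal_apply, ite_mul, zero_mul, Finset.sum_ite_eq', Finset.mem_univ,
    if_true]
  -- evaluate everything in the adapted frame
  simp only [cKS_adapted b hb, dcKS_adapted b hb, inner_adapted b hb, inner_basis b,
    Fin.sum_univ_three, Fin.isValue, Matrix.cons_val_zero, Matrix.cons_val_one, Matrix.cons_val,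
    if_true, show ((0 : Fin 3) = 2) = False by decide, show ((1 : Fin 3) = 2) = False by decide,
    show ((0 : Fin 3) = 1) = False by decide, show ((1 : Fin 3) = 0) = False by decide,
    show ((2 : Fin 3) = 0) = False by decide, show ((2 : Fin 3) = 1) = False by decide, if_false,
    mul_zero, zero_mul, mul_one, one_mul, add_zero, zero_add, sub_zero]
  field_simp
  ring

end Kerr

end Literature.Geometry.Lorentzian

end
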